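import Summits.ResolutionOfSingularities.ResolutionOfSingularities.Theorems.FrobeniusLadderFRationalResolutionDiagonalQuotientGlobal
import Literature.Combinatorics.Optimization.HilbertBasis
import HarnessLib

/-!
# The diagonal bridge for arbitrary diagonalizable groups: `𝔸ᴺ // D(A)` is resolved for every abelian `A`

Support file for crux stmt-ResolutionOfSingularities-15317 (`FrobeniusLadder.FRationalResolution`), line `redirect`,
endgame stub `stub_diagonalizableQuotientResolution`; sequel to `…DiagonalQuotientGlobal.lean` (brick (F): FINITE
abelian `A`). Here the group of weights `A` is an ARBITRARY additive commutative group, i.e. `D(A) = Spec k[A]` is any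
diagonalizable group scheme (a torus times a finite diagonalizable group) acting diagonally on `𝔸ᴺ` with characters
`w : Fin N → A`, and `S₀ = k[x₁,…,x_N]^{D(A)} = k[M]`, `M = {d ∈ ℕᴺ : ∑ dᵢ • wᵢ = 0}`, is the affine quotient
`𝔸ᴺ // D(A)` (Cox's presentation of affine toric varieties; affine GIT quotients by diagonalizable groups).

* `weightZeroMonoid_fg_general` — **Gordan for invariant monoids**: `M` is finitely generated for every abelian `A`.
  The box argument of the finite case is replaced by the tree's PROVED Gordan lemma
  (`Literature.Combinatorics.Optimization.HilbertBasis.intPolyCone_fg`, Schrijver Thm. 16.4): with `L ⊆ ℤᴺ` the kernel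
  of the additive extension `v ↦ ∑ vᵢ • wᵢ` of the weight and `b₁,…,b_r` a `ℤ`-basis of `L`, the lattice form of `M`
  is the image of the polyhedral cone `{y ∈ ℤʳ : B y ≥ 0}` (`B` the matrix of the basis) under `y ↦ B y`;
* `weightZeroMonoid_latticeForm_general`, `hasResolution_Spec_weightZeroMonoidAlgebra_general`,
  **`hasResolution_diagonalizableQuotient`** — as in the finite case: `M ≅ Q ⊆ ℤᴺ` finitely generated and saturated in
  `ℤQ`, so `Spec k[M] ≅ Spec S₀ = 𝔸ᴺ // D(A)` HAS A RESOLUTION OF SINGULARITIES for every field `k`, every `N`, every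
  abelian group `A` and all weights (tree: `hasResolution_Spec_addMonoidAlgebra_of_saturated`, over PROVED Kato (10.4)).

All folklore (Cox–Little–Schenck 2011 §1.3, §5.1, §14; Schrijver 1986 Thm. 16.4); no published fact is used as a
hypothesis and no definition is introduced.
-/

-- single-problem summit: the doubled namespace component is forced
set_option linter.dupNamespace false

noncomputable section

namespace Summit.ResolutionOfSingularities.ResolutionOfSingularities.Theorems.FRationalResolution

open CategoryTheory AlgebraicGeometry TopologicalSpace
open Literature.AlgebraicGeometry.Resolution
open Literature.Combinatorics.Optimization.HilbertBasis

section DiagonalizableQuotient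

variable (k : Type) [Field k] {N : ℕ} {A : Type} [AddCommGroup A]

/-- **Gordan's lemma for the invariant monoid of a diagonalizable action.** For ANY additive commutative group `A`
and weights `w : Fin N → A`, the monoid `M = {d ∈ ℕᴺ : ∑ dᵢ • wᵢ = 0}` is finitely generated: its lattice form
`{v ∈ ℤᴺ : v ≥ 0, ∑ vᵢ • wᵢ = 0} = ℕᴺ ∩ L` (`L` the kernel of the extended weight) is the image of the
polyhedral cone `{y ∈ ℤʳ : B y ≥ 0}` of a `ℤ`-basis matrix `B` of `L`, finitely generated by the tree's Gordan
lemma `intPolyCone_fg`. [folklore; Schrijver1986 Thm. 16.4, CLS2011 §1.3] -/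
theorem weightZeroMonoid_fg_general (w : Fin N → A) :
    (AddMonoidHom.mker (Finsupp.weight w : (Fin N →₀ ℕ) →+ A)).FG := by
  classical
  set M := AddMonoidHom.mker (Finsupp.weight w : (Fin N →₀ ℕ) →+ A) with hM
  -- the exponent embedding `ι : ℕᴺ ↪ ℤᴺ`
  let ι : (Fin N →₀ ℕ) →+ (Fin N → ℤ) :=
    { toFun := fun d i => ((d i : ℕ) : ℤ)
      map_zero' := by ext i; simp
      map_add' := fun d d' => by ext i; simp }
  have hι : ∀ d i, ι d i = ((d i : ℕ) : ℤ) := fun d i => rfl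
  have hιinj : Function.Injective ι := by
    intro d d' h
    ext i
    have := congrFun h i
    rwa [hι, hι, Nat.cast_inj] at this
  -- the `ℤ`-linear extension of the weight to `ℤᴺ`
  let ψ : (Fin N → ℤ) →ₗ[ℤ] A :=
    { toFun := fun v => ∑ i, v i • w i
      map_add' := fun v v' => by simp [add_smul, Finset.sum_add_distrib]
      map_smul' := fun c v => by simp [Finset.smul_sum, smul_smul] }
  have hψ : ∀ v, ψ v = ∑ i, v i • w i := fun v => rfl
  have hψι : ∀ d, ψ (ι d) = Finsupp.weight w d := by
    intro d
    rw [hψ, Finsupp.weight_apply, Finsupp.sum_fintype _ _ (fun i => by simp)]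
    refine Finset.sum_congr rfl fun i _ => ?_
    rw [hι, natCast_zsmul]
  set Q : AddSubmonoid (Fin N → ℤ) := M.map ι with hQ
  have hmemQ : ∀ v, v ∈ Q ↔ (∀ i, 0 ≤ v i) ∧ ψ v = 0 := by
    intro v
    constructor
    · rintro ⟨d, hd, rfl⟩
      refine ⟨fun i => by rw [hι]; exact Int.natCast_nonneg _, ?_⟩
      rw [hψι]
      exact AddMonoidHom.mem_mker.mp hd
    · rintro ⟨hv, hv0⟩
      let d : Fin N →₀ ℕ := Finsupp.equivFunOnFinite.symm fun i => (v i).toNat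
      have hd : ι d = v := by
        ext i
        rw [hι]
        exact Int.toNat_of_nonneg (hv i)
      refine ⟨d, ?_, hd⟩
      change d ∈ M
      exact AddMonoidHom.mem_mker.mpr (by rw [← hψι, hd, hv0])
  -- a `ℤ`-basis of the kernel lattice `L`
  set L : Submodule ℤ (Fin N → ℤ) := LinearMap.ker ψ with hL
  set r := Module.finrank ℤ ↥L with hr
  let b := Module.finBasis ℤ ↥L
  let B : Matrix (Fin N) (Fin r) ℤ := fun i j => ((b j : ↥L) : Fin N → ℤ) i
  let θ : (Fin r → ℤ) →+ (Fin N → ℤ) := (Matrix.mulVecLin B).toAddMonoidHom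
  have hθ : ∀ y, θ y = B.mulVec y := fun y => rfl
  have hθb : ∀ y : Fin r → ℤ, θ y = ((b.equivFun.symm y : ↥L) : Fin N → ℤ) := by
    intro y
    have hsum : ((b.equivFun.symm y : ↥L) : Fin N → ℤ) = ∑ j, y j • ((b j : ↥L) : Fin N → ℤ) := by
      rw [Module.Basis.equivFun_symm_apply]
      change L.subtype (∑ j, y j • b j) = _
      simp_rw [map_sum, map_zsmul]
      rfl
    rw [hθ, hsum]
    ext i
    simp only [Matrix.mulVec, dotProduct, Finset.sum_apply, Pi.smul_apply, smul_eq_mul, B]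
    exact Finset.sum_congr rfl fun j _ => mul_comm _ _
  -- `Q` is the image of the polyhedral cone `{y : B y ≥ 0}`
  have hQC : Q = (intPolyCone B).map θ := by
    ext v
    rw [hmemQ, AddSubmonoid.mem_map]
    constructor
    · rintro ⟨hv, hv0⟩
      have hvL : v ∈ L := by rw [hL, LinearMap.mem_ker]; exact hv0
      refine ⟨b.equivFun ⟨v, hvL⟩, ?_, ?_⟩
      · rw [mem_intPolyCone, ← hθ, hθb, LinearEquiv.symm_apply_apply]
        exact fun i => hv i
      · rw [hθb, LinearEquiv.symm_apply_apply]
    · rintro ⟨y, hy, rfl⟩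
      rw [mem_intPolyCone, ← hθ] at hy
      refine ⟨fun i => hy i, ?_⟩
      have hmem : θ y ∈ L := by rw [hθb]; exact (b.equivFun.symm y).2
      rw [hL, LinearMap.mem_ker] at hmem
      exact hmem
  have hQfg : Q.FG := by
    rw [hQC]
    exact AddSubmonoid.FG.map (intPolyCone_fg B) θ
  -- transport back along `M ≅ Q`
  let e : ↥M ≃+ ↥Q := AddSubmonoid.equivMapOfInjective M ι hιinj
  haveI : AddMonoid.FG ↥Q := (AddMonoid.fg_iff_addSubmonoid_fg Q).2 hQfg
  exact (AddMonoid.fg_iff_addSubmonoid_fg M).1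
    (AddMonoid.fg_of_surjective e.symm.toAddMonoidHom e.symm.surjective)

/-- **Lattice form of the invariant monoid, arbitrary abelian `A`.** `M = ker (weight w) ⊆ ℕᴺ` is isomorphic
(`d ↦ (dᵢ) ∈ ℤᴺ`) to a finitely generated submonoid `Q ⊆ ℤᴺ` SATURATED in the subgroup it spans, with
`k[M] ≅ k[Q]` — verbatim the finite case (`weightZeroMonoid_latticeForm`) with Gordan (`weightZeroMonoid_fg_general`)
in place of the box argument. [folklore; CLS2011 §1.3] -/
theorem weightZeroMonoid_latticeForm_general (w : Fin N → A) :
    ∃ Q : AddSubmonoid (Fin N → ℤ), Q.FG ∧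
      (∀ v ∈ Submodule.span ℤ (Q : Set (Fin N → ℤ)), ∀ m : ℕ, 0 < m → m • v ∈ Q → v ∈ Q) ∧
      Nonempty (AddMonoidAlgebra k ↥(AddMonoidHom.mker (Finsupp.weight w : (Fin N →₀ ℕ) →+ A)) ≃ₐ[k]
        AddMonoidAlgebra k ↥Q) := by
  classical
  set M := AddMonoidHom.mker (Finsupp.weight w : (Fin N →₀ ℕ) →+ A) with hM
  -- the exponent embedding `ι : ℕᴺ ↪ ℤᴺ`
  let ι : (Fin N →₀ ℕ) →+ (Fin N → ℤ) :=
    { toFun := fun d i => ((d i : ℕ) : ℤ)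
      map_zero' := by ext i; simp
      map_add' := fun d d' => by ext i; simp }
  have hι : ∀ d i, ι d i = ((d i : ℕ) : ℤ) := fun d i => rfl
  have hιinj : Function.Injective ι := by
    intro d d' h
    ext i
    have := congrFun h i
    rwa [hι, hι, Nat.cast_inj] at this
  -- the additive extension of the weight to `ℤᴺ`
  let ψ : (Fin N → ℤ) →+ A :=
    { toFun := fun v => ∑ i, v i • w i
      map_zero' := by simp
      map_add' := fun v v' => by simp [add_smul, Finset.sum_add_distrib] }
  have hψ : ∀ v, ψ v = ∑ i, v i • w i := fun v => rfl
  have hψι : ∀ d, ψ (ι d) = Finsupp.weight w d := by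
    intro d
    rw [hψ, Finsupp.weight_apply, Finsupp.sum_fintype _ _ (fun i => by simp)]
    refine Finset.sum_congr rfl fun i _ => ?_
    rw [hι, natCast_zsmul]
  set Q : AddSubmonoid (Fin N → ℤ) := M.map ι with hQ
  have hmemQ : ∀ v, v ∈ Q ↔ (∀ i, 0 ≤ v i) ∧ ψ v = 0 := by
    intro v
    constructor
    · rintro ⟨d, hd, rfl⟩
      refine ⟨fun i => by rw [hι]; exact Int.natCast_nonneg _, ?_⟩
      rw [hψι]
      exact AddMonoidHom.mem_mker.mp hd
    · rintro ⟨hv, hv0⟩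
      let d : Fin N →₀ ℕ := Finsupp.equivFunOnFinite.symm fun i => (v i).toNat
      have hd : ι d = v := by
        ext i
        rw [hι]
        exact Int.toNat_of_nonneg (hv i)
      refine ⟨d, ?_, hd⟩
      change d ∈ M
      exact AddMonoidHom.mem_mker.mpr (by rw [← hψι, hd, hv0])
  refine ⟨Q, ?_, ?_, ?_⟩
  · exact AddSubmonoid.FG.map (weightZeroMonoid_fg_general w) ι
  · intro v hv m hm hmv
    rw [hmemQ] at hmv ⊢
    obtain ⟨hpos, hzero⟩ := hmv
    refine ⟨fun i => ?_, ?_⟩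
    · have h := hpos i
      rw [Pi.smul_apply, nsmul_eq_mul] at h
      by_contra hlt
      exact absurd h (not_le.mpr (mul_neg_of_pos_of_neg (by exact_mod_cast hm) (not_le.mp hlt)))
    · -- `ψ` kills `Q`, hence its `ℤ`-span
      have hker : ∀ u ∈ Submodule.span ℤ (Q : Set (Fin N → ℤ)), ψ u = 0 := by
        intro u hu
        refine Submodule.span_induction (p := fun u _ => ψ u = 0) ?_ ?_ ?_ ?_ hu
        · intro u hu
          exact ((hmemQ u).1 hu).2
        · exact map_zero ψ
        · intro u u' _ _ hu hu'
          rw [map_add, hu, hu', add_zero]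
        · intro z u _ hu
          rw [map_zsmul, hu, smul_zero]
      exact hker v hv
  · exact ⟨AddMonoidAlgebra.domCongr k k (AddSubmonoid.equivMapOfInjective M ι hιinj)⟩

/-- **RESOLUTION OF `Spec k[M]` FOR THE INVARIANT MONOID OF ANY DIAGONALIZABLE ACTION**: for every field `k`,
every `N`, every additive commutative group `A` and every `w : Fin N → A`, the spectrum of the monoid algebra of
`M = {d ∈ ℕᴺ : ∑ dᵢ • wᵢ = 0}` has a resolution of singularities. [folklore + Kato1994 (10.4)] -/
theorem hasResolution_Spec_weightZeroMonoidAlgebra_general (w : Fin N → A) :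
    Scheme.HasResolution
      (Spec (.of (AddMonoidAlgebra k ↥(AddMonoidHom.mker (Finsupp.weight w : (Fin N →₀ ℕ) →+ A))))) := by
  obtain ⟨Q, hQfg, hsat, ⟨e⟩⟩ := weightZeroMonoid_latticeForm_general k w
  have hres : Scheme.HasResolution (Spec (.of (AddMonoidAlgebra k ↥Q))) :=
    hasResolution_Spec_addMonoidAlgebra_of_saturated k Q hQfg hsat
  exact Scheme.HasResolution.of_iso (Spec.map e.toRingEquiv.toCommRingCatIso.hom) hres

/-- **EVERY AFFINE QUOTIENT `𝔸ᴺ // D(A)` BY A DIAGONALIZABLE GROUP SCHEME, OVER EVERY FIELD, HAS A RESOLUTION OF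
SINGULARITIES.** For a field `k`, an additive commutative group `A` (so `D(A) = Spec k[A]` is any diagonalizable
group scheme — a split torus times a finite diagonalizable group, tame or wild) and weights `w : Fin N → A`, the
spectrum of the degree-`0` part `S₀ = k[x₁,…,x_N]^{D(A)}` of `S = k[x₁,…,x_N]` with the diagonal grading
(`MvPolynomial.weightedGradedAlgebra`) has a resolution of singularities; the finite case is
`hasResolution_diagonalQuotient`. [folklore + Kato1994 (10.4)] -/
theorem hasResolution_diagonalizableQuotient [DecidableEq A] (w : Fin N → A) :
    letI := MvPolynomial.weightedGradedAlgebra k w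
    Scheme.HasResolution
      (Spec (.of ↥(SetLike.GradeZero.subalgebra (MvPolynomial.weightedHomogeneousSubmodule k w)))) := by
  letI := MvPolynomial.weightedGradedAlgebra k w
  obtain ⟨e⟩ := weightZeroMonoid_algEquiv_gradeZero k w
  exact Scheme.HasResolution.of_iso (Spec.map e.toRingEquiv.toCommRingCatIso.inv)
    (hasResolution_Spec_weightZeroMonoidAlgebra_general k w)

/-- The same, with the degree-`0` part written as `𝒮 0` (`SetLike.GradeZero.instCommRing`), as the redirect line's
stubs write degree-`0` parts. [folklore + Kato1994 (10.4)] -/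
theorem hasResolution_diagonalizableQuotient' [DecidableEq A] (w : Fin N → A) :
    letI := MvPolynomial.weightedGradedAlgebra k w
    Scheme.HasResolution (Spec (.of ↥(MvPolynomial.weightedHomogeneousSubmodule k w 0))) :=
  hasResolution_diagonalizableQuotient k w

end DiagonalizableQuotient

end Summit.ResolutionOfSingularities.ResolutionOfSingularities.Theorems.FRationalResolution

end
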